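import Mathlib.Analysis.Calculus.ContDiff.Bounds
import Mathlib.Analysis.Calculus.IteratedDeriv.Lemmas
import Mathlib.Analysis.Calculus.Deriv.Inv
import Mathlib.Analysis.SpecialFunctions.Pow.Real
import Mathlib.Analysis.SpecialFunctions.ExpDeriv
import Mathlib.MeasureTheory.Integral.IntegralEqImproper
import Literature.Analysis.Fourier.StationaryPhaseInert
import HarnessLib

/-!
# Non-stationary phase with `X`-inert weights: Kıral–Petrow–Young 2019 Lemma 3.1 (1) = Blomer–Khan–Young 2013 Lemma 8.1, PROVED

Topic `Literature/Analysis/Fourier`; proof-lane companion of the carpet `Literature/Analysis/Fourier/StationaryPhaseInert.lean`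
(named facts of [KiralPetrowYoung2019]) and of `StationaryPhaseInertHolds.lean` (which records that the carpet's facts, typed
with `ContDiff ℝ ⊤ = C^ω`, are vacuous and discharges them as typed).  THEOREMS ONLY; no definition, no named fact.

THE RESULT (as printed, [KiralPetrowYoung2019, Lemma 3.1, first bullet] = [BlomerKhanYoung2013, Lemma 8.1] in the
inert normalisation).  «Suppose that `w = w_T(t)` is a family of `X`-inert functions, with compact support on `[Z, 2Z]`,
so that `w^{(j)}(t) ≪ (Z/X)^{-j}`.  Also suppose that `φ` is smooth and satisfies `φ^{(j)}(t) ≪ Y/Zʲ` for some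
`Y/X² ≥ R ≥ 1` and all `t` in the support of `w`.  Let `I = ∫ w(t) e^{iφ(t)} dt`.  If `|φ′(t)| ≫ Y/Z` for all `t` in the
support of `w`, then `I ≪_A Z R^{-A}` for `A` arbitrarily large.»  Here: `norm_oscInt_le_of_nonstationary`, typed with
the SAME binders as the carpet's `kpy2019_lemma31_nonstationary` (tables `C_w, C_φ`, the constant `c` of `|φ′| ≥ cY/Z`,
and `A` quantified BEFORE the instance; conclusion `‖oscInt w φ‖ ≤ K·Z·R^{-A}` with `K = K(C_w, C_φ, c, A)`), except that
«smooth» is `ContDiff ℝ ∞` (`C^∞`): this is the FAITHFUL letter.  Since `C^ω ⊆ C^∞` (`ContDiff.of_le le_top`), the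
carpet's typed fact follows from it non-vacuously as well (it is already discharged, as typed, by
`kpy2019_lemma31_nonstationary_holds` in `StationaryPhaseInertHolds.lean`; the gate's dedup rule forbids restating it here).

THE PROOF follows [BlomerKhanYoung2013, Lemma 8.1 (proof)] (held: arXiv:1203.2573, §8): with the operator
`𝒟(f) = −(f/(iφ′))′ = i·(f/φ′)′` one has `∫ f e^{iφ} = ∫ 𝒟ⁿ(f) e^{iφ}` for every `n` (integration by parts on the line,
boundary terms absent by compact support: `oscInt_eq_oscInt_step`, Mathlib's `integral_mul_deriv_eq_deriv_mul_of_integrable`),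
and `|I| ≤ (β − α)‖𝒟ⁿ(w)‖_∞` (`norm_oscInt_le_of_forall_le`, `β − α = Z`).  DEVIATION (bookkeeping only): BKY bound
`‖𝒟ⁿ w‖_∞` through the explicit monomial expansion `𝒟ⁿ f = Σ_{ν=n}^{2n} Σ_μ f^{(μ)} (φ′)^{-ν} Σ c·Π (φ^{(l)})^{γ_l}`; here
the same estimate is organised as an INDUCTIVE JET BOUND — if `‖f^{(j)}‖ ≤ N ρʲ` on `[Z, 2Z]` for `j ≤ m + 1`
(`ρ = X/Z`) then `‖(𝒟f)^{(j)}‖ ≤ 2^{m+1} B_v ρ N · ρʲ` for `j ≤ m` (`norm_iteratedDeriv_step_le`, Leibniz), where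
`|(1/φ′)^{(j)}| ≤ B_v ρʲ`, `B_v = (Z/(cY))·M^{2ⁿ−1}`, `M = max(1, 4ⁿ·Σ_{i≤n+2}|C_φ(i)|/c)` is the reciprocal table obtained
from `(1/φ′)′ = −φ″(1/φ′)²` by induction (`abs_iteratedDeriv_le_of_deriv_eq_neg_mul_sq`, `abs_iteratedDeriv_inv_deriv_le`).
Each step gains the factor `ρ·(Z/(cY)) = X/(cY) ≤ 1/(cR)` (only `Y/X ≥ R` is used, as KPY remark after Lemma 3.1), so after
`n = ⌈A⌉₊` steps `|I| ≤ Z·N₀·(2^{n+1}M^{2ⁿ−1}/c)ⁿ·R^{-n} ≤ K Z R^{-A}` with `N₀ = Σ_{j≤n}|C_w(j)|`,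
`K = N₀ (2^{n+1} M^{2ⁿ−1}/c)ⁿ`.

TOOLS proved here in reusable form (§1): the one-variable Leibniz bounds at a point of an OPEN set
(`norm_iteratedDeriv_mul_le_of_isOpen`, `norm_iteratedDeriv_smul_le_of_isOpen`, from Mathlib's
`norm_iteratedFDerivWithin_mul_le` / `_smul_le`) and their «geometric tables multiply» corollaries
(`sum_choose_mul_le_of_geometric`, `norm_iteratedDeriv_mul/smul_le_of_geometric_of_isOpen`; cf. the global versions in
`Literature/Analysis/Calculus/IteratedDerivLeibnizBound.lean`).

## References
* [KiralPetrowYoung2019] E. M. Kıral, I. Petrow, M. P. Young, *Oscillatory integrals with uniformity in parameters*,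
  J. Théor. Nombres Bordeaux 31 (2019) 145–159 (arXiv:1710.00916), Lemma 3.1 (1) and the remark following it.
* [BlomerKhanYoung2013] V. Blomer, R. Khan, M. Young, *Distribution of mass of holomorphic cusp forms*, Duke Math. J.
  162 (2013) 2609–2644 (arXiv:1203.2573), §8, Lemma 8.1 and its proof.
-/

noncomputable section

open MeasureTheory Set Filter Topology Finset
open scoped ContDiff

namespace Literature.Analysis.Fourier

namespace InertStationaryPhase

/-! ### §1 Leibniz bounds at a point of an open set, and the arithmetic of geometric derivative tables -/

section Leibniz

variable {𝔸 : Type*} [NormedRing 𝔸] [NormedAlgebra ℝ 𝔸] {F : Type*} [NormedAddCommGroup F] [NormedSpace ℝ F]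

/-- At a point of an open set, `iteratedDerivWithin` and `iteratedDeriv` have the same norm (for the `Fréchet` form
used by Mathlib's Leibniz estimates). [folklore] -/
private theorem norm_iteratedFDerivWithin_eq_norm_iteratedDeriv_of_isOpen {U : Set ℝ} (hU : IsOpen U) {x : ℝ}
    (hx : x ∈ U) (n : ℕ) (f : ℝ → F) :
    ‖iteratedFDerivWithin ℝ n f U x‖ = ‖iteratedDeriv n f x‖ := by
  rw [norm_iteratedFDerivWithin_eq_norm_iteratedDerivWithin, iteratedDerivWithin_of_isOpen hU hx]

/-- **Leibniz bound, product in a normed algebra, local form**: for `f, g` smooth on an open set `U ∋ x`,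
`‖(fg)^{(n)}(x)‖ ≤ Σᵢ C(n,i) ‖f^{(i)}(x)‖ ‖g^{(n-i)}(x)‖` (Mathlib's `norm_iteratedFDerivWithin_mul_le` on `U`; the norm
form of Leibniz' formula [cite: HormanderALPDO1, §1.1 (1.1.9)]). -/
theorem norm_iteratedDeriv_mul_le_of_isOpen {U : Set ℝ} (hU : IsOpen U) {f g : ℝ → 𝔸}
    (hf : ContDiffOn ℝ ∞ f U) (hg : ContDiffOn ℝ ∞ g U) {x : ℝ} (hx : x ∈ U) (n : ℕ) :
    ‖iteratedDeriv n (fun y => f y * g y) x‖ ≤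
      ∑ i ∈ Finset.range (n + 1), (n.choose i : ℝ) * ‖iteratedDeriv i f x‖ * ‖iteratedDeriv (n - i) g x‖ := by
  have h := norm_iteratedFDerivWithin_mul_le (𝕜 := ℝ) hf hg hU.uniqueDiffOn hx (n := n) (mod_cast le_top)
  rw [norm_iteratedFDerivWithin_eq_norm_iteratedDeriv_of_isOpen hU hx] at h
  refine h.trans (le_of_eq (Finset.sum_congr rfl fun i _ => ?_))
  rw [norm_iteratedFDerivWithin_eq_norm_iteratedDeriv_of_isOpen hU hx,
    norm_iteratedFDerivWithin_eq_norm_iteratedDeriv_of_isOpen hU hx]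

/-- **Leibniz bound, scalar action, local form**: for `f : ℝ → ℝ` and `g : ℝ → F` smooth on an open set `U ∋ x`,
`‖(f • g)^{(n)}(x)‖ ≤ Σᵢ C(n,i) ‖f^{(i)}(x)‖ ‖g^{(n-i)}(x)‖` (Mathlib's `norm_iteratedFDerivWithin_smul_le` on `U`; the
norm form of Leibniz' formula [cite: HormanderALPDO1, §1.1 (1.1.9)]). -/
theorem norm_iteratedDeriv_smul_le_of_isOpen {U : Set ℝ} (hU : IsOpen U) {f : ℝ → ℝ} {g : ℝ → F}
    (hf : ContDiffOn ℝ ∞ f U) (hg : ContDiffOn ℝ ∞ g U) {x : ℝ} (hx : x ∈ U) (n : ℕ) :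
    ‖iteratedDeriv n (fun y => f y • g y) x‖ ≤
      ∑ i ∈ Finset.range (n + 1), (n.choose i : ℝ) * ‖iteratedDeriv i f x‖ * ‖iteratedDeriv (n - i) g x‖ := by
  have h := norm_iteratedFDerivWithin_smul_le (𝕜 := ℝ) hf hg hU.uniqueDiffOn hx (n := n) (mod_cast le_top)
  rw [norm_iteratedFDerivWithin_eq_norm_iteratedDeriv_of_isOpen hU hx] at h
  refine h.trans (le_of_eq (Finset.sum_congr rfl fun i _ => ?_))
  rw [norm_iteratedFDerivWithin_eq_norm_iteratedDeriv_of_isOpen hU hx,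
    norm_iteratedFDerivWithin_eq_norm_iteratedDeriv_of_isOpen hU hx]

/-- **Geometric derivative tables multiply**: if `aᵢ ≤ A ρⁱ` and `bᵢ ≤ B ρⁱ` for `i ≤ n` (nonnegative sequences), then
`Σᵢ C(n,i) aᵢ b_{n-i} ≤ 2ⁿ A B ρⁿ`. [folklore] -/
private theorem sum_choose_mul_le_of_geometric {n : ℕ} {a b : ℕ → ℝ} {A B ρ : ℝ} (hρ : 0 ≤ ρ)
    (ha0 : ∀ i, 0 ≤ a i) (hb0 : ∀ i, 0 ≤ b i) (ha : ∀ i ≤ n, a i ≤ A * ρ ^ i)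
    (hb : ∀ i ≤ n, b i ≤ B * ρ ^ i) :
    ∑ i ∈ Finset.range (n + 1), (n.choose i : ℝ) * a i * b (n - i) ≤ 2 ^ n * A * B * ρ ^ n := by
  have hA0 : 0 ≤ A := by
    have h := ha 0 (Nat.zero_le n); rw [pow_zero, mul_one] at h; exact (ha0 0).trans h
  calc ∑ i ∈ Finset.range (n + 1), (n.choose i : ℝ) * a i * b (n - i)
      ≤ ∑ i ∈ Finset.range (n + 1), (n.choose i : ℝ) * (A * B * ρ ^ n) := by
        refine Finset.sum_le_sum fun i hi => ?_
        have hin : i ≤ n := Nat.lt_succ_iff.1 (Finset.mem_range.1 hi)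
        rw [mul_assoc]
        refine mul_le_mul_of_nonneg_left ?_ (Nat.cast_nonneg _)
        calc a i * b (n - i) ≤ (A * ρ ^ i) * (B * ρ ^ (n - i)) :=
            mul_le_mul (ha i hin) (hb (n - i) (Nat.sub_le n i)) (hb0 _) (mul_nonneg hA0 (pow_nonneg hρ i))
          _ = A * B * ρ ^ n := by
            rw [show A * ρ ^ i * (B * ρ ^ (n - i)) = A * B * (ρ ^ i * ρ ^ (n - i)) by ring, ← pow_add,
              Nat.add_sub_cancel' hin]
    _ = 2 ^ n * A * B * ρ ^ n := by
        rw [← Finset.sum_mul]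
        have h : ∑ i ∈ Finset.range (n + 1), (n.choose i : ℝ) = 2 ^ n := by
          exact_mod_cast Nat.sum_range_choose n
        rw [h]; ring

/-- **Product of two factors with geometric derivative bounds on an open set**: if `‖f^{(i)}(x)‖ ≤ A ρⁱ` and
`‖g^{(i)}(x)‖ ≤ B ρⁱ` for `i ≤ n`, then `‖(fg)^{(n)}(x)‖ ≤ 2ⁿ A B ρⁿ` (Leibniz' formula
[cite: HormanderALPDO1, §1.1 (1.1.9)] and `Σᵢ C(n,i) = 2ⁿ`). -/
theorem norm_iteratedDeriv_mul_le_of_geometric_of_isOpen {U : Set ℝ} (hU : IsOpen U) {f g : ℝ → 𝔸}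
    (hf : ContDiffOn ℝ ∞ f U) (hg : ContDiffOn ℝ ∞ g U) {x : ℝ} (hx : x ∈ U) {n : ℕ} {A B ρ : ℝ}
    (hρ : 0 ≤ ρ) (hA : ∀ i ≤ n, ‖iteratedDeriv i f x‖ ≤ A * ρ ^ i)
    (hB : ∀ i ≤ n, ‖iteratedDeriv i g x‖ ≤ B * ρ ^ i) :
    ‖iteratedDeriv n (fun y => f y * g y) x‖ ≤ 2 ^ n * A * B * ρ ^ n :=
  (norm_iteratedDeriv_mul_le_of_isOpen hU hf hg hx n).trans
    (sum_choose_mul_le_of_geometric hρ (fun _ => norm_nonneg _) (fun _ => norm_nonneg _) hA hB)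

/-- **Scalar action of a factor with geometric derivative bounds on an open set**: if `‖f^{(i)}(x)‖ ≤ A ρⁱ` and
`‖g^{(i)}(x)‖ ≤ B ρⁱ` for `i ≤ n` (`f` real, `g` vector valued), then `‖(f • g)^{(n)}(x)‖ ≤ 2ⁿ A B ρⁿ` (Leibniz'
formula [cite: HormanderALPDO1, §1.1 (1.1.9)] and `Σᵢ C(n,i) = 2ⁿ`). -/
theorem norm_iteratedDeriv_smul_le_of_geometric_of_isOpen {U : Set ℝ} (hU : IsOpen U) {f : ℝ → ℝ} {g : ℝ → F}
    (hf : ContDiffOn ℝ ∞ f U) (hg : ContDiffOn ℝ ∞ g U) {x : ℝ} (hx : x ∈ U) {n : ℕ} {A B ρ : ℝ}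
    (hρ : 0 ≤ ρ) (hA : ∀ i ≤ n, ‖iteratedDeriv i f x‖ ≤ A * ρ ^ i)
    (hB : ∀ i ≤ n, ‖iteratedDeriv i g x‖ ≤ B * ρ ^ i) :
    ‖iteratedDeriv n (fun y => f y • g y) x‖ ≤ 2 ^ n * A * B * ρ ^ n :=
  (norm_iteratedDeriv_smul_le_of_isOpen hU hf hg hx n).trans
    (sum_choose_mul_le_of_geometric hρ (fun _ => norm_nonneg _) (fun _ => norm_nonneg _) hA hB)

end Leibniz

/-! ### §2 Derivative tables for the reciprocal `1/φ′` (from `(1/φ′)′ = −φ″·(1/φ′)²`) -/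

section Reciprocal

/-- Iterating derivatives composes additively in the order. [folklore] -/
private theorem iteratedDeriv_iteratedDeriv {F : Type*} [NormedAddCommGroup F] [NormedSpace ℝ F] (a b : ℕ) (f : ℝ → F) :
    iteratedDeriv a (iteratedDeriv b f) = iteratedDeriv (a + b) f := by
  rw [iteratedDeriv_eq_iterate, iteratedDeriv_eq_iterate, iteratedDeriv_eq_iterate]
  exact (Function.iterate_add_apply deriv a b f).symm

/-- Exponent bookkeeping: `2·(2ᵏ − 1) + 1 = 2ᵏ⁺¹ − 1`. [folklore] -/
private theorem two_mul_two_pow_sub_one_add_one (k : ℕ) : 2 * (2 ^ k - 1) + 1 = 2 ^ (k + 1) - 1 := by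
  have h : 1 ≤ 2 ^ k := Nat.one_le_two_pow
  rw [pow_succ]
  omega

/-- **Abstract reciprocal induction** (the engine behind `|(1/φ′)^{(j)}| ≪ (Z/Y)·Z^{-j}`).  Let `v, ψ` be smooth on an
open set `U ⊇ I` with `v′ = −ψ·v²` on `U`; suppose `|v| ≤ L` on `I` and `|ψ^{(a)}| ≤ P ρ₀ᵃ` on `I` for `a ≤ n`, and
`P·L ≤ D·ρ₀`.  If `M ≥ 1` and `M ≥ 4ⁿ D` then for all `k ≤ n`, `j ≤ k`, `t ∈ I`:
`|v^{(j)}(t)| ≤ L · M^{2ᵏ−1} · ρ₀ʲ` (induction on `k`: `v^{(k+1)} = −(ψ·v·v)^{(k)}`, Leibniz twice).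
[cite: BlomerKhanYoung2013, Lemma 8.1 (proof)] -/
theorem abs_iteratedDeriv_le_of_deriv_eq_neg_mul_sq {U I : Set ℝ} (hU : IsOpen U) (hIU : I ⊆ U)
    {v ψ : ℝ → ℝ} (hv : ContDiffOn ℝ ∞ v U) (hψ : ContDiffOn ℝ ∞ ψ U)
    (hder : Set.EqOn (deriv v) (fun s => -(ψ s * (v s * v s))) U)
    {L P ρ₀ D M : ℝ} (hL : 0 ≤ L) (hρ₀ : 0 ≤ ρ₀) (hD : 0 ≤ D) (hM1 : 1 ≤ M) {n : ℕ}
    (hMn : (4 : ℝ) ^ n * D ≤ M) (hPL : P * L ≤ D * ρ₀)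
    (hv0 : ∀ t ∈ I, |v t| ≤ L) (hψb : ∀ a ≤ n, ∀ t ∈ I, |iteratedDeriv a ψ t| ≤ P * ρ₀ ^ a) :
    ∀ k ≤ n, ∀ j ≤ k, ∀ t ∈ I, |iteratedDeriv j v t| ≤ L * M ^ (2 ^ k - 1) * ρ₀ ^ j := by
  intro k
  induction k with
  | zero =>
    intro _ j hj t ht
    obtain rfl : j = 0 := Nat.le_zero.mp hj
    simpa using hv0 t ht
  | succ k ih =>
    intro hk j hj t ht
    have hkn : k ≤ n := Nat.le_of_succ_le hk
    have hM0 : 0 ≤ M := zero_le_one.trans hM1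
    -- the table at level `k`, and its monotonicity in the level
    set Bk : ℝ := L * M ^ (2 ^ k - 1) with hBk
    have hBk0 : 0 ≤ Bk := mul_nonneg hL (pow_nonneg hM0 _)
    have hmono : L * M ^ (2 ^ k - 1) ≤ L * M ^ (2 ^ (k + 1) - 1) := by
      refine mul_le_mul_of_nonneg_left (pow_le_pow_right₀ hM1 ?_) hL
      have := two_mul_two_pow_sub_one_add_one k
      omega
    rcases Nat.lt_or_ge j (k + 1) with hjk | hjk
    · -- lower orders: induction hypothesis and monotonicity
      have h := ih hkn j (Nat.lt_succ_iff.mp hjk) t ht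
      exact h.trans (mul_le_mul_of_nonneg_right hmono (pow_nonneg hρ₀ _))
    · -- the top order `j = k + 1`
      obtain rfl : j = k + 1 := le_antisymm hj hjk
      have htU : t ∈ U := hIU ht
      -- `v^{(k+1)} = (v′)^{(k)} = −(ψ·v·v)^{(k)}` near `t`
      have hev : deriv v =ᶠ[𝓝 t] fun s => -(ψ s * (v s * v s)) :=
        hder.eventuallyEq_of_mem (hU.mem_nhds htU)
      have hrw : iteratedDeriv (k + 1) v t = -(iteratedDeriv k (fun s => ψ s * (v s * v s)) t) := by
        rw [iteratedDeriv_succ', (hev.iteratedDeriv k).eq_of_nhds, iteratedDeriv_fun_neg]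
      rw [hrw, abs_neg]
      -- bounds for `v·v` at orders `≤ k`
      have hvv : ∀ i ≤ k, ‖iteratedDeriv i (fun s => v s * v s) t‖ ≤ (2 ^ k * Bk * Bk) * ρ₀ ^ i := by
        intro i hi
        have h := norm_iteratedDeriv_mul_le_of_geometric_of_isOpen hU hv hv htU (n := i) hρ₀
          (fun l hl => by
            rw [Real.norm_eq_abs]; exact ih hkn l (hl.trans hi) t ht)
          (fun l hl => by
            rw [Real.norm_eq_abs]; exact ih hkn l (hl.trans hi) t ht)
        refine h.trans ?_
        have h2 : (2 : ℝ) ^ i ≤ 2 ^ k := pow_le_pow_right₀ one_le_two hi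
        have : 2 ^ i * Bk * Bk * ρ₀ ^ i ≤ 2 ^ k * Bk * Bk * ρ₀ ^ i := by
          have hnn : 0 ≤ Bk * Bk * ρ₀ ^ i := mul_nonneg (mul_nonneg hBk0 hBk0) (pow_nonneg hρ₀ _)
          nlinarith
        simpa [hBk, mul_assoc] using this
      -- Leibniz for `ψ · (v·v)` at order `k`
      have hmain := norm_iteratedDeriv_mul_le_of_geometric_of_isOpen hU hψ (hv.mul hv) htU (n := k) hρ₀
        (fun i hi => by rw [Real.norm_eq_abs]; exact hψb i (hi.trans hkn) t ht) hvv
      rw [Real.norm_eq_abs] at hmain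
      refine hmain.trans ?_
      -- arithmetic: `2ᵏ·P·(2ᵏ·Bk·Bk)·ρ₀ᵏ ≤ L·M^{2^{k+1}−1}·ρ₀^{k+1}`
      have h4 : (2 : ℝ) ^ k * (2 ^ k) = 4 ^ k := by
        rw [← mul_pow]; norm_num
      have hP0 : 0 ≤ P * L := by
        -- from `|ψ| ≤ P` at `t` (order 0) we get `0 ≤ P` when `I` is inhabited; here `t ∈ I`
        have hP : 0 ≤ P := by
          have h := hψb 0 (Nat.zero_le n) t ht
          rw [pow_zero, mul_one] at h
          exact (abs_nonneg _).trans h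
        exact mul_nonneg hP hL
      have h4k : (4 : ℝ) ^ k * D ≤ M := by
        refine le_trans ?_ hMn
        exact mul_le_mul_of_nonneg_right (pow_le_pow_right₀ (by norm_num) hkn) hD
      have hexp : M ^ (2 ^ k - 1) * M ^ (2 ^ k - 1) * M = M ^ (2 ^ (k + 1) - 1) := by
        rw [← pow_add, ← pow_succ, ← two_mul, two_mul_two_pow_sub_one_add_one]
      calc 2 ^ k * P * (2 ^ k * Bk * Bk) * ρ₀ ^ k
          = 4 ^ k * (P * L) * L * (M ^ (2 ^ k - 1) * M ^ (2 ^ k - 1)) * ρ₀ ^ k := by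
            rw [hBk, ← h4]; ring
        _ ≤ 4 ^ k * (D * ρ₀) * L * (M ^ (2 ^ k - 1) * M ^ (2 ^ k - 1)) * ρ₀ ^ k := by
            have hnn : 0 ≤ L * (M ^ (2 ^ k - 1) * M ^ (2 ^ k - 1)) * ρ₀ ^ k :=
              mul_nonneg (mul_nonneg hL (mul_nonneg (pow_nonneg hM0 _) (pow_nonneg hM0 _))) (pow_nonneg hρ₀ _)
            have := mul_le_mul_of_nonneg_left hPL (mul_nonneg (pow_nonneg (by norm_num : (0:ℝ) ≤ 4) k) hnn)
            nlinarith [this]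
        _ = (4 ^ k * D) * (L * (M ^ (2 ^ k - 1) * M ^ (2 ^ k - 1)) * ρ₀ ^ (k + 1)) := by ring
        _ ≤ M * (L * (M ^ (2 ^ k - 1) * M ^ (2 ^ k - 1)) * ρ₀ ^ (k + 1)) := by
            refine mul_le_mul_of_nonneg_right h4k ?_
            exact mul_nonneg (mul_nonneg hL (mul_nonneg (pow_nonneg hM0 _) (pow_nonneg hM0 _))) (pow_nonneg hρ₀ _)
        _ = L * M ^ (2 ^ (k + 1) - 1) * ρ₀ ^ (k + 1) := by rw [← hexp]; ring

/-- The set where `φ′ ≠ 0` is open (for `φ` of class `C^∞`). [folklore] -/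
private theorem isOpen_deriv_ne_zero {φ : ℝ → ℝ} (hφ : ContDiff ℝ ∞ φ) : IsOpen {t : ℝ | deriv φ t ≠ 0} :=
  isOpen_ne_fun (hφ.continuous_deriv (by simp)) continuous_const

/-- `φ′` is `C^∞`. [folklore] -/
private theorem contDiff_deriv_of_contDiff {φ : ℝ → ℝ} (hφ : ContDiff ℝ ∞ φ) : ContDiff ℝ ∞ (deriv φ) :=
  (contDiff_infty_iff_deriv.mp hφ).2

/-- `1/φ′` is `C^∞` on `{φ′ ≠ 0}`. [folklore] -/
private theorem contDiffOn_inv_deriv {φ : ℝ → ℝ} (hφ : ContDiff ℝ ∞ φ) :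
    ContDiffOn ℝ ∞ (fun s => (deriv φ s)⁻¹) {t : ℝ | deriv φ t ≠ 0} :=
  (contDiff_deriv_of_contDiff hφ).contDiffOn.inv fun _ ht => ht

/-- `(1/φ′)′ = −φ″·(1/φ′)²` on `{φ′ ≠ 0}`. [folklore] -/
private theorem deriv_inv_deriv_eqOn {φ : ℝ → ℝ} (hφ : ContDiff ℝ ∞ φ) :
    Set.EqOn (deriv fun s => (deriv φ s)⁻¹)
      (fun s => -(iteratedDeriv 2 φ s * ((deriv φ s)⁻¹ * (deriv φ s)⁻¹))) {t : ℝ | deriv φ t ≠ 0} := by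
  intro t ht
  have hd : HasDerivAt (deriv φ) (deriv (deriv φ) t) t :=
    (((contDiff_deriv_of_contDiff hφ).differentiable (by simp)).differentiableAt).hasDerivAt
  have h := (hd.inv ht).deriv
  have h2 : deriv (deriv φ) t = iteratedDeriv 2 φ t := by
    rw [iteratedDeriv_succ, iteratedDeriv_one]
  simp only at h ⊢
  rw [show (fun s => (deriv φ s)⁻¹) = (deriv φ)⁻¹ from rfl, h, h2]
  field_simp

/-- **The reciprocal table for `1/φ′`.**  If `φ` is `C^∞`, `|φ^{(j)}| ≤ C_φ(j)·Y/Zʲ` on `[Z, 2Z]` for `j ≥ 1` and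
`|φ′| ≥ cY/Z` there (`Z, Y, c > 0`), then for every `n` and all `j ≤ n`, `t ∈ [Z, 2Z]`:
`|(1/φ′)^{(j)}(t)| ≤ (Z/(cY)) · M^{2ⁿ−1} · (1/Z)ʲ` with `M = max(1, 4ⁿ Σ_{i<n+3}|C_φ(i)|/c)` — a constant depending only
on `(C_φ, c, n)`. [cite: BlomerKhanYoung2013, Lemma 8.1 (proof)] -/
theorem abs_iteratedDeriv_inv_deriv_le {φ : ℝ → ℝ} (hφ : ContDiff ℝ ∞ φ) {Z Y c : ℝ} (hZ : 0 < Z) (hY : 0 < Y)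
    (hc : 0 < c) {Cφ : ℕ → ℝ} (n : ℕ)
    (hφb : ∀ j : ℕ, 1 ≤ j → ∀ t ∈ Icc Z (2 * Z), |iteratedDeriv j φ t| ≤ Cφ j * Y / Z ^ j)
    (hφ' : ∀ t ∈ Icc Z (2 * Z), c * Y / Z ≤ |deriv φ t|) :
    ∀ j ≤ n, ∀ t ∈ Icc Z (2 * Z),
      |iteratedDeriv j (fun s => (deriv φ s)⁻¹) t| ≤
        Z / (c * Y) * (max 1 (4 ^ n * ((∑ i ∈ Finset.range (n + 3), |Cφ i|) / c))) ^ (2 ^ n - 1) * (1 / Z) ^ j := by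
  set Aφ : ℝ := ∑ i ∈ Finset.range (n + 3), |Cφ i| with hAφ
  have hAφ0 : 0 ≤ Aφ := Finset.sum_nonneg fun i _ => abs_nonneg _
  have hCle : ∀ i < n + 3, Cφ i ≤ Aφ := fun i hi =>
    (le_abs_self _).trans (Finset.single_le_sum (f := fun i => |Cφ i|) (fun i _ => abs_nonneg _)
      (Finset.mem_range.mpr hi))
  have hU := isOpen_deriv_ne_zero hφ
  have hlam : 0 < c * Y / Z := div_pos (mul_pos hc hY) hZ
  have hIU : Icc Z (2 * Z) ⊆ {t : ℝ | deriv φ t ≠ 0} := fun t ht h0 => by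
    have := hφ' t ht; rw [h0, abs_zero] at this; exact absurd this (not_le.mpr hlam)
  have hψ : ContDiff ℝ ∞ (iteratedDeriv 2 φ) := by
    rw [iteratedDeriv_eq_iterate]; exact hφ.iterate_deriv 2
  refine abs_iteratedDeriv_le_of_deriv_eq_neg_mul_sq hU hIU (contDiffOn_inv_deriv hφ) hψ.contDiffOn
    (deriv_inv_deriv_eqOn hφ) (L := Z / (c * Y)) (P := Aφ * Y / Z ^ 2) (ρ₀ := 1 / Z) (D := Aφ / c)
    (by positivity) (by positivity) (by positivity) (le_max_left _ _) (le_max_right _ _) ?_ ?_ ?_ n le_rfl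
  · -- `P·L = D·ρ₀`
    rw [show Aφ * Y / Z ^ 2 * (Z / (c * Y)) = Aφ / c * (1 / Z) by field_simp]
  · -- `|1/φ′| ≤ Z/(cY)`
    intro t ht
    rw [abs_inv]
    calc |deriv φ t|⁻¹ ≤ (c * Y / Z)⁻¹ := inv_anti₀ hlam (hφ' t ht)
      _ = Z / (c * Y) := by rw [inv_div]
  · -- `|ψ^{(a)}| ≤ P ρ₀ᵃ`
    intro a ha t ht
    rw [iteratedDeriv_iteratedDeriv]
    have h := hφb (a + 2) (by omega) t ht
    refine h.trans ?_
    have hYZ : 0 ≤ Y / Z ^ (a + 2) := by positivity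
    calc Cφ (a + 2) * Y / Z ^ (a + 2) = Cφ (a + 2) * (Y / Z ^ (a + 2)) := by ring
      _ ≤ Aφ * (Y / Z ^ (a + 2)) := mul_le_mul_of_nonneg_right (hCle _ (by omega)) hYZ
      _ = Aφ * Y / Z ^ 2 * (1 / Z) ^ a := by
        rw [one_div_pow, pow_add]; field_simp

end Reciprocal

/-! ### §3 The operator `𝒟f = i·(f/φ′)′` preserves the class «smooth, supported in `[Z,2Z]`, geometric jets» -/

section Step

/-- A derivative of a `C^∞` function is `C^∞`. [folklore] -/
private theorem contDiff_deriv_of_contDiff' {F : Type*} [NormedAddCommGroup F] [NormedSpace ℝ F] {u : ℝ → F}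
    (hu : ContDiff ℝ ∞ u) : ContDiff ℝ ∞ (deriv u) :=
  (contDiff_infty_iff_deriv.mp hu).2

/-- If `f` is `C^∞`, vanishes off a closed set `I`, and `v` is `C^∞` on an open set `U ⊇ I`, then `v • f` is `C^∞`
on the whole line (it is `v • f` on `U` and `0` near every point outside `I`). [folklore] -/
private theorem contDiff_smul_of_eq_zero_off {U I : Set ℝ} (hU : IsOpen U) (hI : IsClosed I) (hIU : I ⊆ U)
    {v : ℝ → ℝ} {f : ℝ → ℂ} (hv : ContDiffOn ℝ ∞ v U) (hf : ContDiff ℝ ∞ f) (hf0 : ∀ t ∉ I, f t = 0) :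
    ContDiff ℝ ∞ (fun s => v s • f s) := by
  rw [contDiff_iff_contDiffAt]
  intro t
  by_cases ht : t ∈ U
  · exact (hv.smul hf.contDiffOn).contDiffAt (hU.mem_nhds ht)
  · have htI : t ∉ I := fun h => ht (hIU h)
    have hev : (fun s => v s • f s) =ᶠ[𝓝 t] fun _ => (0 : ℂ) := by
      filter_upwards [hI.isOpen_compl.mem_nhds htI] with s hs
      simp [hf0 s hs]
    exact contDiffAt_const.congr_of_eventuallyEq hev

/-- A function vanishing off a closed set `I` has all its derivatives vanishing off `I`. [folklore] -/
private theorem deriv_eq_zero_off {I : Set ℝ} (hI : IsClosed I) {u : ℝ → ℂ} (hu0 : ∀ t ∉ I, u t = 0) :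
    ∀ t ∉ I, deriv u t = 0 := by
  intro t ht
  have hev : u =ᶠ[𝓝 t] fun _ => (0 : ℂ) := by
    filter_upwards [hI.isOpen_compl.mem_nhds ht] with s hs
    exact hu0 s hs
  rw [hev.deriv_eq, deriv_const]

/-- **The step**: if `|v^{(j)}| ≤ B_v ρʲ` and `‖f^{(j)}‖ ≤ N ρʲ` on `[Z, 2Z]` for `j ≤ m + 1` (`v` smooth on an open
`U ⊇ [Z, 2Z]`, `f` smooth), then `g = i·(v f)′` satisfies `‖g^{(j)}‖ ≤ (2^{m+1} B_v ρ N)·ρʲ` on `[Z, 2Z]` for `j ≤ m`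
(Leibniz).  This is one application of the operator `𝒟` of [cite: BlomerKhanYoung2013, Lemma 8.1 (proof)]. -/
theorem norm_iteratedDeriv_step_le {U : Set ℝ} {Z : ℝ} (hU : IsOpen U) (hIU : Icc Z (2 * Z) ⊆ U)
    {v : ℝ → ℝ} {f : ℝ → ℂ} (hv : ContDiffOn ℝ ∞ v U) (hf : ContDiff ℝ ∞ f) {m : ℕ} {Bv N ρ : ℝ}
    (hρ : 0 ≤ ρ) (hBv : 0 ≤ Bv) (hN : 0 ≤ N)
    (hvb : ∀ j ≤ m + 1, ∀ t ∈ Icc Z (2 * Z), |iteratedDeriv j v t| ≤ Bv * ρ ^ j)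
    (hfb : ∀ j ≤ m + 1, ∀ t ∈ Icc Z (2 * Z), ‖iteratedDeriv j f t‖ ≤ N * ρ ^ j) :
    ∀ j ≤ m, ∀ t ∈ Icc Z (2 * Z),
      ‖iteratedDeriv j (fun s => Complex.I * deriv (fun r => v r • f r) s) t‖ ≤ (2 ^ (m + 1) * Bv * ρ * N) * ρ ^ j := by
  intro j hj t ht
  have htU : t ∈ U := hIU ht
  rw [iteratedDeriv_const_mul_field, norm_mul, Complex.norm_I, one_mul, ← iteratedDeriv_succ']
  have h := norm_iteratedDeriv_smul_le_of_geometric_of_isOpen hU hv hf.contDiffOn htU (n := j + 1) hρ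
    (fun i hi => by rw [Real.norm_eq_abs]; exact hvb i (by omega) t ht) (fun i hi => hfb i (by omega) t ht)
  refine h.trans ?_
  have h2 : (2 : ℝ) ^ (j + 1) ≤ 2 ^ (m + 1) := pow_le_pow_right₀ one_le_two (by omega)
  have hnn : 0 ≤ Bv * N * ρ ^ (j + 1) := mul_nonneg (mul_nonneg hBv hN) (pow_nonneg hρ _)
  calc 2 ^ (j + 1) * Bv * N * ρ ^ (j + 1) = 2 ^ (j + 1) * (Bv * N * ρ ^ (j + 1)) := by ring
    _ ≤ 2 ^ (m + 1) * (Bv * N * ρ ^ (j + 1)) := mul_le_mul_of_nonneg_right h2 hnn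
    _ = 2 ^ (m + 1) * Bv * ρ * N * ρ ^ j := by ring

end Step

/-! ### §4 The integration-by-parts identity `∫ f e^{iφ} = ∫ 𝒟(f) e^{iφ}` -/

section IBP

/-- `t ↦ e^{iφ(t)}` has derivative `e^{iφ(t)}·(iφ′(t))`. [folklore] -/
private theorem hasDerivAt_cexp_I_mul {φ : ℝ → ℝ} (hφ : ContDiff ℝ ∞ φ) (t : ℝ) :
    HasDerivAt (fun s => Complex.exp (Complex.I * φ s))
      (Complex.exp (Complex.I * φ t) * (Complex.I * (deriv φ t : ℝ))) t := by
  have h : HasDerivAt φ (deriv φ t) t := ((hφ.differentiable (by simp)).differentiableAt).hasDerivAt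
  have h1 : HasDerivAt (fun s => Complex.I * (φ s : ℂ)) (Complex.I * (deriv φ t : ℝ)) t := by
    simpa using h.ofReal_comp.const_mul Complex.I
  exact h1.cexp

/-- **`∫ f e^{iφ} = ∫ i (f/φ′)′ e^{iφ}`** for `f` smooth and supported in `[Z, 2Z]`, where `v = 1/φ′` on `[Z, 2Z]` and
`v • f` is smooth: one integration by parts on the line, boundary terms absent by compact support.  This is the
identity `∫ f e^{ih} = ∫ 𝒟(f) e^{ih}` of [cite: BlomerKhanYoung2013, Lemma 8.1 (proof)]. -/
theorem oscInt_eq_oscInt_step {φ : ℝ → ℝ} (hφ : ContDiff ℝ ∞ φ) {Z : ℝ} {v : ℝ → ℝ} {f : ℝ → ℂ}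
    (hu : ContDiff ℝ ∞ (fun s => v s • f s)) (hf0 : ∀ t ∉ Icc Z (2 * Z), f t = 0)
    (hvφ : ∀ t ∈ Icc Z (2 * Z), deriv φ t * v t = 1) :
    oscInt f φ = oscInt (fun s => Complex.I * deriv (fun r => v r • f r) s) φ := by
  set u : ℝ → ℂ := fun s => v s • f s with hu_def
  set e : ℝ → ℂ := fun s => Complex.exp (Complex.I * φ s) with he_def
  set e' : ℝ → ℂ := fun s => Complex.exp (Complex.I * φ s) * (Complex.I * (deriv φ s : ℝ)) with he'_def
  -- `u` vanishes off `[Z, 2Z]`, hence so does `u′`; both have compact support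
  have hu0 : ∀ t ∉ Icc Z (2 * Z), u t = 0 := fun t ht => by simp [hu_def, hf0 t ht]
  have hdu0 : ∀ t ∉ Icc Z (2 * Z), deriv u t = 0 := deriv_eq_zero_off isClosed_Icc hu0
  have hus : HasCompactSupport u := HasCompactSupport.intro isCompact_Icc hu0
  have hdus : HasCompactSupport (deriv u) := HasCompactSupport.intro isCompact_Icc hdu0
  -- continuity
  have huc : Continuous u := hu.continuous
  have hduc : Continuous (deriv u) := hu.continuous_deriv (by simp)
  have hφc : Continuous φ := hφ.continuous
  have hdφc : Continuous (deriv φ) := hφ.continuous_deriv (by simp)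
  have hec : Continuous e := by
    simp only [he_def]; fun_prop
  have he'c : Continuous e' := by
    simp only [he'_def]; fun_prop
  -- pointwise: `f e = u · (−i) · e′`
  have hpt : ∀ s, f s * e s = -Complex.I * (u s * e' s) := by
    intro s
    by_cases hs : s ∈ Icc Z (2 * Z)
    · have h1 : ((deriv φ s : ℝ) : ℂ) * ((v s : ℝ) : ℂ) = 1 := by exact_mod_cast hvφ s hs
      simp only [hu_def, he'_def, Complex.real_smul]
      linear_combination (-(f s * Complex.exp (Complex.I * φ s))) * h1
        + (((deriv φ s : ℝ) : ℂ) * ((v s : ℝ) : ℂ) * f s * Complex.exp (Complex.I * φ s)) * Complex.I_sq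
    · simp [hu0 s hs, hf0 s hs]
  -- integration by parts on the line
  have hibp := integral_mul_deriv_eq_deriv_mul_of_integrable (u := u) (v := e) (u' := deriv u) (v' := e')
    (fun x _ => ((hu.differentiable (by simp)).differentiableAt).hasDerivAt)
    (fun x _ => hasDerivAt_cexp_I_mul hφ x)
    ((huc.mul he'c).integrable_of_hasCompactSupport hus.mul_right)
    ((hduc.mul hec).integrable_of_hasCompactSupport hdus.mul_right)
    ((huc.mul hec).integrable_of_hasCompactSupport hus.mul_right)
  unfold oscInt
  calc ∫ t, f t * Complex.exp (Complex.I * φ t) = ∫ t, -Complex.I * (u t * e' t) := by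
        refine integral_congr_ae (Eventually.of_forall fun s => ?_); exact hpt s
    _ = -Complex.I * ∫ t, u t * e' t := integral_const_mul _ _
    _ = -Complex.I * -∫ t, deriv u t * e t := by rw [hibp]
    _ = Complex.I * ∫ t, deriv u t * e t := by ring
    _ = ∫ t, Complex.I * (deriv u t * e t) := (integral_const_mul _ _).symm
    _ = ∫ t, Complex.I * deriv (fun r => v r • f r) t * Complex.exp (Complex.I * φ t) := by
        refine integral_congr_ae (Eventually.of_forall fun s => ?_)
        simp only [hu_def, he_def, mul_assoc]

end IBP

/-! ### §5 The trivial bound `|∫ g e^{iφ}| ≤ Z · sup|g|` for `g` supported in `[Z, 2Z]` -/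

section Sup

/-- If `g` vanishes off `[Z, 2Z]` (`Z ≥ 0`) and `‖g‖ ≤ N` there, then `|∫ g e^{iφ}| ≤ N·Z` (the first inequality of the
last display of [cite: BlomerKhanYoung2013, Lemma 8.1 (proof)], `|I| ≤ (β−α)‖𝒟ⁿ w‖_∞`). -/
theorem norm_oscInt_le_of_forall_le {g : ℝ → ℂ} (φ : ℝ → ℝ) {Z N : ℝ} (hZ : 0 ≤ Z)
    (hg0 : ∀ t ∉ Icc Z (2 * Z), g t = 0) (hgN : ∀ t ∈ Icc Z (2 * Z), ‖g t‖ ≤ N) :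
    ‖oscInt g φ‖ ≤ N * Z := by
  unfold oscInt
  rw [← setIntegral_eq_integral_of_forall_compl_eq_zero (s := Icc Z (2 * Z))
    (fun t ht => by rw [hg0 t ht, zero_mul])]
  have hvol : volume (Icc Z (2 * Z)) < ⊤ := by simp
  refine (norm_setIntegral_le_of_norm_le_const (C := N) hvol fun t ht => ?_).trans ?_
  · rw [norm_mul, mul_comm Complex.I, Complex.norm_exp_ofReal_mul_I, mul_one]; exact hgN t ht
  · rw [Real.volume_real_Icc, show 2 * Z - Z = Z by ring, max_eq_left hZ]

end Sup

/-! ### §6 Assembly: `n = ⌈A⌉` integrations by parts -/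

section Main

/-- `(1/R)ⁿ ≤ R^{-A}` for `R ≥ 1` and `n = ⌈A⌉₊`. [folklore] -/
private theorem one_div_pow_natCeil_le_rpow_neg {R A : ℝ} (hR : 1 ≤ R) :
    (1 / R) ^ ⌈A⌉₊ ≤ R ^ (-A) := by
  have hR0 : 0 < R := one_pos.trans_le hR
  rw [one_div, inv_pow, ← Real.rpow_natCast, ← Real.rpow_neg hR0.le]
  exact Real.rpow_le_rpow_of_exponent_le hR (neg_le_neg (Nat.le_ceil A))

/-- **Kıral–Petrow–Young 2019, Lemma 3.1 (1) = Blomer–Khan–Young 2013, Lemma 8.1 — the SMOOTH (faithful) letter,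
PROVED.**  «Suppose that `w = w_T(t)` is a family of `X`-inert functions, with compact support on `[Z, 2Z]`, so that
`w^{(j)}(t) ≪ (Z/X)^{-j}`.  Also suppose that `φ` is smooth and satisfies `φ^{(j)}(t) ≪ Y/Zʲ` for some `Y/X² ≥ R ≥ 1`
and all `t` in the support of `w`.  Let `I = ∫ w(t) e^{iφ(t)} dt`.  If `|φ′(t)| ≫ Y/Z` for all `t` in the support of
`w`, then `I ≪_A Z R^{-A}` for `A` arbitrarily large.»  Typed exactly as the carpet's named fact
`kpy2019_lemma31_nonstationary` (tables `C_w, C_φ, c` and `A` quantified BEFORE the instance; constant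
`K = K(C_w, C_φ, c, A)`), except that «smooth» is `ContDiff ℝ ∞` (`C^∞`) — the carpet's `ContDiff ℝ ⊤` is `C^ω` and
makes its fact vacuous (`InertOn.eq_zero` in `StationaryPhaseInertHolds.lean`).  PROOF = the printed proof of
[BKY, Lemma 8.1]: with `𝒟(f) = −(f/(iφ′))′ = i(f/φ′)′` one has `∫ f e^{iφ} = ∫ 𝒟ⁿ(f) e^{iφ}` (`oscInt_eq_oscInt_step`,
`n` times) and `|I| ≤ Z·‖𝒟ⁿ w‖_∞` (`norm_oscInt_le_of_forall_le`); BKY's explicit monomial expansion of `𝒟ⁿ w` is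
replaced by the inductive jet bound `‖(𝒟ᵏw)^{(j)}‖ ≤ N₀ (2^{n+1} B_v X/Z)ᵏ (X/Z)ʲ` (`norm_iteratedDeriv_step_le`, with
the reciprocal table `|(1/φ′)^{(j)}| ≤ B_v (X/Z)ʲ`, `B_v = (Z/(cY))·M^{2ⁿ−1}`, of `abs_iteratedDeriv_inv_deriv_le`), each
step gaining `X/(cY) ≤ 1/(cR)`; `n = ⌈A⌉₊`, `K = (Σ_{j≤n}|C_w(j)|)·(2^{n+1} M^{2ⁿ−1}/c)ⁿ`,
`M = max(1, 4ⁿ Σ_{i≤n+2}|C_φ(i)|/c)`.  (The paper's remark that `Y/X ≥ R` suffices is visible here: only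
`X/Y ≤ 1/R` is used.) [cite: KiralPetrowYoung2019, Lemma 3.1 (1)] -/
theorem norm_oscInt_le_of_nonstationary :
    ∀ (Cw Cφ : ℕ → ℝ) (c : ℝ), 0 < c → ∀ A : ℝ, 0 ≤ A → ∃ K : ℝ,
    ∀ (w : ℝ → ℂ) (φ : ℝ → ℝ) (Z X Y R : ℝ), 0 < Z → 1 ≤ X → 0 < Y → 1 ≤ R → R ≤ Y / X ^ 2 →
      ContDiff ℝ ∞ w → (∀ t, t ∉ Icc Z (2 * Z) → w t = 0) →
      (∀ (j : ℕ) (t : ℝ), ‖iteratedDeriv j w t‖ ≤ Cw j * (X / Z) ^ j) → ContDiff ℝ ∞ φ →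
      (∀ j : ℕ, 1 ≤ j → ∀ t ∈ Icc Z (2 * Z), |iteratedDeriv j φ t| ≤ Cφ j * Y / Z ^ j) →
      (∀ t ∈ Icc Z (2 * Z), c * Y / Z ≤ |deriv φ t|) →
        ‖oscInt w φ‖ ≤ K * Z * R ^ (-A) := by
  intro Cw Cφ c hc A _
  -- the constants: `n = ⌈A⌉`, `N₀ = Σ_{j≤n} |C_w j|`, `M = max(1, 4ⁿ Σ_{i≤n+2}|C_φ i|/c)`, `Bφ = M^{2ⁿ-1}`
  set n : ℕ := ⌈A⌉₊ with hn
  set N₀ : ℝ := ∑ j ∈ Finset.range (n + 1), |Cw j| with hN₀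
  set M : ℝ := max 1 (4 ^ n * ((∑ i ∈ Finset.range (n + 3), |Cφ i|) / c)) with hM
  set Bφ : ℝ := M ^ (2 ^ n - 1) with hBφ
  refine ⟨N₀ * (2 ^ (n + 1) * Bφ / c) ^ n, ?_⟩
  intro w φ Z X Y R hZ hX hY hR hRY hw hw0 hwb hφ hφb hφ'
  have hN₀0 : 0 ≤ N₀ := Finset.sum_nonneg fun j _ => abs_nonneg _
  have hM1 : 1 ≤ M := le_max_left _ _
  have hM0 : 0 ≤ M := zero_le_one.trans hM1
  have hBφ0 : 0 ≤ Bφ := pow_nonneg hM0 _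
  have hX0 : 0 < X := one_pos.trans_le hX
  have hR0 : 0 < R := one_pos.trans_le hR
  -- the scales
  set ρ : ℝ := X / Z with hρ
  have hρ0 : 0 ≤ ρ := div_nonneg hX0.le hZ.le
  have hρ1 : 1 / Z ≤ ρ := div_le_div_of_nonneg_right hX hZ.le
  -- the open set `U = {φ′ ≠ 0} ⊇ [Z, 2Z]` and the reciprocal `v = 1/φ′`
  set U : Set ℝ := {t : ℝ | deriv φ t ≠ 0} with hU_def
  have hU : IsOpen U := isOpen_deriv_ne_zero hφ
  have hlam : 0 < c * Y / Z := div_pos (mul_pos hc hY) hZ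
  have hIU : Icc Z (2 * Z) ⊆ U := fun t ht h0 => by
    have := hφ' t ht; rw [h0, abs_zero] at this; exact absurd this (not_le.mpr hlam)
  set v : ℝ → ℝ := fun s => (deriv φ s)⁻¹ with hv_def
  have hv : ContDiffOn ℝ ∞ v U := contDiffOn_inv_deriv hφ
  have hvφ : ∀ t ∈ Icc Z (2 * Z), deriv φ t * v t = 1 := fun t ht => mul_inv_cancel₀ (hIU ht)
  -- the reciprocal table: `|v^{(j)}| ≤ Bv ρʲ` for `j ≤ n`, `Bv = (Z/(cY))·Bφ`
  set Bv : ℝ := Z / (c * Y) * Bφ with hBv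
  have hBv0 : 0 ≤ Bv := mul_nonneg (div_nonneg hZ.le (mul_pos hc hY).le) hBφ0
  have hvb : ∀ j ≤ n, ∀ t ∈ Icc Z (2 * Z), |iteratedDeriv j v t| ≤ Bv * ρ ^ j := by
    intro j hj t ht
    have h := abs_iteratedDeriv_inv_deriv_le hφ hZ hY hc n hφb hφ' j hj t ht
    refine h.trans ?_
    rw [hBv, hBφ, hM]
    exact mul_le_mul_of_nonneg_left (pow_le_pow_left₀ (by positivity) hρ1 j)
      (mul_nonneg (div_nonneg hZ.le (mul_pos hc hY).le) (pow_nonneg hM0 _))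
  -- the jets of `w` up to order `n`: `‖w^{(j)}‖ ≤ N₀ ρʲ`
  have hwN : ∀ j ≤ n, ∀ t ∈ Icc Z (2 * Z), ‖iteratedDeriv j w t‖ ≤ N₀ * ρ ^ j := by
    intro j hj t _
    refine (hwb j t).trans (mul_le_mul_of_nonneg_right ?_ (pow_nonneg hρ0 _))
    exact (le_abs_self _).trans (Finset.single_le_sum (f := fun i => |Cw i|) (fun i _ => abs_nonneg _)
      (Finset.mem_range.mpr (Nat.lt_succ_of_le hj)))
  -- the per-step factor
  set q : ℝ := 2 ^ (n + 1) * Bv * ρ with hq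
  have hq0 : 0 ≤ q := mul_nonneg (mul_nonneg (pow_nonneg zero_le_two _) hBv0) hρ0
  -- INDUCTION over the number `k ≤ n` of integrations by parts
  have key : ∀ k ≤ n, ∃ g : ℝ → ℂ, ContDiff ℝ ∞ g ∧ (∀ t ∉ Icc Z (2 * Z), g t = 0) ∧
      (∀ j ≤ n - k, ∀ t ∈ Icc Z (2 * Z), ‖iteratedDeriv j g t‖ ≤ N₀ * q ^ k * ρ ^ j) ∧
      oscInt w φ = oscInt g φ := by
    intro k
    induction k with
    | zero =>
      intro _
      refine ⟨w, hw, hw0, fun j hj t ht => ?_, rfl⟩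
      rw [pow_zero, mul_one]; exact hwN j (by omega) t ht
    | succ k ih =>
      intro hk
      obtain ⟨g, hg, hg0, hgb, hI⟩ := ih (Nat.le_of_succ_le hk)
      have hu : ContDiff ℝ ∞ (fun s => v s • g s) :=
        contDiff_smul_of_eq_zero_off hU isClosed_Icc hIU hv hg hg0
      refine ⟨fun s => Complex.I * deriv (fun r => v r • g r) s, contDiff_const.mul (contDiff_deriv_of_contDiff' hu),
        fun t ht => ?_, fun j hj t ht => ?_, hI.trans (oscInt_eq_oscInt_step hφ hu hg0 hvφ)⟩
      · -- vanishing off `[Z, 2Z]`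
        have h0 : ∀ t ∉ Icc Z (2 * Z), (fun s => v s • g s) t = 0 := fun t ht => by simp [hg0 t ht]
        show Complex.I * deriv (fun r => v r • g r) t = 0
        rw [deriv_eq_zero_off isClosed_Icc h0 t ht, mul_zero]
      · -- the jet bound, by the step lemma with `m = n - (k+1)`
        have hm : n - k = (n - (k + 1)) + 1 := by omega
        have hstep := norm_iteratedDeriv_step_le hU hIU hv hg (m := n - (k + 1)) hρ0 hBv0
          (mul_nonneg hN₀0 (pow_nonneg hq0 k))
          (fun j hj t ht => hvb j (by omega) t ht) (fun j hj t ht => hgb j (by omega) t ht) j hj t ht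
        refine hstep.trans (mul_le_mul_of_nonneg_right ?_ (pow_nonneg hρ0 _))
        have h2 : (2 : ℝ) ^ (n - (k + 1) + 1) ≤ 2 ^ (n + 1) := pow_le_pow_right₀ one_le_two (by omega)
        have hnn : 0 ≤ Bv * ρ * (N₀ * q ^ k) := mul_nonneg (mul_nonneg hBv0 hρ0) (mul_nonneg hN₀0 (pow_nonneg hq0 k))
        calc 2 ^ (n - (k + 1) + 1) * Bv * ρ * (N₀ * q ^ k) = 2 ^ (n - (k + 1) + 1) * (Bv * ρ * (N₀ * q ^ k)) := by
              ring
          _ ≤ 2 ^ (n + 1) * (Bv * ρ * (N₀ * q ^ k)) := mul_le_mul_of_nonneg_right h2 hnn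
          _ = N₀ * q ^ (k + 1) := by rw [hq]; ring
  -- after `n` steps: the sup bound
  obtain ⟨g, _, hg0, hgb, hI⟩ := key n le_rfl
  have hsup : ‖oscInt g φ‖ ≤ N₀ * q ^ n * Z :=
    norm_oscInt_le_of_forall_le φ hZ.le hg0 fun t ht => by
      have h := hgb 0 (Nat.zero_le _) t ht
      rwa [iteratedDeriv_zero, pow_zero, mul_one] at h
  rw [hI]
  refine hsup.trans ?_
  -- arithmetic: `q = 2^{n+1} Bφ · X/(cY) ≤ 2^{n+1} Bφ /(cR)` and `(1/R)ⁿ ≤ R^{-A}`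
  have hXY : X / Y ≤ 1 / R := by
    rw [div_le_div_iff₀ hY hR0, one_mul]
    have h1 : R * X ^ 2 ≤ Y := (le_div_iff₀ (by positivity)).mp hRY
    nlinarith [mul_le_mul_of_nonneg_left hX (mul_nonneg hR0.le hX0.le)]
  have hq1 : q ≤ 2 ^ (n + 1) * Bφ / c * (1 / R) := by
    have : q = 2 ^ (n + 1) * Bφ / c * (X / Y) := by
      rw [hq, hBv, hρ]; field_simp
    rw [this]
    exact mul_le_mul_of_nonneg_left hXY (by positivity)
  have hqn : q ^ n ≤ (2 ^ (n + 1) * Bφ / c) ^ n * R ^ (-A) := by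
    calc q ^ n ≤ (2 ^ (n + 1) * Bφ / c * (1 / R)) ^ n := pow_le_pow_left₀ hq0 hq1 n
      _ = (2 ^ (n + 1) * Bφ / c) ^ n * (1 / R) ^ n := mul_pow _ _ _
      _ ≤ (2 ^ (n + 1) * Bφ / c) ^ n * R ^ (-A) :=
          mul_le_mul_of_nonneg_left (one_div_pow_natCeil_le_rpow_neg hR) (by positivity)
  calc N₀ * q ^ n * Z ≤ N₀ * ((2 ^ (n + 1) * Bφ / c) ^ n * R ^ (-A)) * Z :=
        mul_le_mul_of_nonneg_right (mul_le_mul_of_nonneg_left hqn hN₀0) hZ.le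
    _ = N₀ * (2 ^ (n + 1) * Bφ / c) ^ n * Z * R ^ (-A) := by ring

end Main

end InertStationaryPhase

end Literature.Analysis.Fourier
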